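import Summits.QuantumFields.BalabanUV.Beta.MultiscaleCoerciveGauge

/-!
# Beta / MultiscaleCoerciveCover — FROM THE CELL SUM TO A GLOBAL (DIRICHLET-TYPE) LOWER BOUND: if the charted cells COVER the
# support of `f` (and are pairwise disjoint), then `Σ_k ‖f‖²_{cell k} = ‖f‖²`, so parts (C)∕(F)'s level-count-free cell sums give
# `(1 − θ)·κ·n_max⁻²·‖f‖² ≤ ⟨f, levelOp f⟩` for every `f` supported in the union of the cells — the LOCAL COERCIVITY INPUT of
# the decay half (node (w)): for the Dirichlet problem on a hull made of level-`l` cells the constant is `κ/S_l²`, independent of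
# the hull size and of the number of levels (unit `b2b-balaban-beta-d4-p2`, GEN 7, MODEL crew; claim «MULTISCALE-POINCARE-MODEL»
# journal l.16779∕l.18140, part (I) = sub-node (w1) of O.2 skeleton §8.4; over (C) p226432 and (F) p227519)

HONEST FRAMING: discharging `BetaPertH` makes Bałaban's UV stability UNCONDITIONAL — NOT the continuum limit, NOT the
Clay problem.  HONEST DEPENDENCY (verbatim): «continuum YM on T⁴ ⇐ BetaPertH ∧ nine spine estimates (0/9 proved);
BetaPertH ⇐ (D1) ∧ (D4) ∧ CAP+tail; G-an2-4 gates asym, D1 and NE2/3/4.»  THIS MODULE DISCHARGES NOTHING of `BetaPertH`,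
asserts NOTHING printed and cites nothing as a fact (ABSOLUTE RULE): [folklore] bookkeeping about the pv21 component MODEL
(`B9Thm37GlueTorusCovLevels.levelOp` with GENERAL data).  SHAPES located at [B9] = `Balaban1985BackgroundPropagators` (3.24) p. 394,
Thm 3.1 p. 397 (local prefactor `(L^jη)²` of `G′(□)`), [B6] = `Balaban1984PropagatorsII` (2.43) p. 230 (the localized
propagators `G′(□)`).  NOT the decay half itself; no Dirichlet hole geometry; nothing of Bałaban's own operators.  No class
change on row D4 (critical-path width 0; D4 DISCHARGE NO DATE); NOT BetaPertH, NOT continuum, NOT Clay, NOT summit progress.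

CONTENT (kernel, 0 sorry).  §1 `sum_sq_eq_sum_cells` (disjoint charted cells covering the support ⟹ `‖f‖² = Σ_k‖f‖²_{cell k}`),
`sum_cells_weight_ge` (a weighted cell sum with weights `≥ w_min ≥ 0` dominates `w_min‖f‖²`).  §2 ENDs **`coercive_of_cover`**
(tree-gauge route, from `multiscale_coercive_scaled`) and **`coercive_of_cover_gauge`** (|A|-half route, from
`multiscale_coercive_gauge_scaled`): `(1 − θ)·κ·n_max⁻²·Σ_p f(p)² ≤ ⟨f, levelOp f⟩`.
-/

namespace Summit.QuantumFields.BalabanUV.Beta.MultiscaleCoerciveCover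

open Finset Function
open Summit.QuantumFields.BalabanUV.Beta.BoxPoincare
open Summit.QuantumFields.BalabanUV.Beta.CovariantBoxPoincare
open Summit.QuantumFields.BalabanUV.Beta.CovariantBoxPoincareGauge
open Summit.QuantumFields.BalabanUV.Beta.MultiscaleCoercive
open Summit.QuantumFields.BalabanUV.Beta.MultiscaleCoerciveGauge
open Literature.MathematicalPhysics.QuantumFieldTheory.Balaban1983to89.B9Thm37Glue (covD)
open Literature.MathematicalPhysics.QuantumFieldTheory.Balaban1983to89.B9Thm37GlueTorusCovLevels (levelOp)

noncomputable section

variable {St Bd B Cp J K : Type} [Fintype St] [DecidableEq St] [DecidableEq B] [Fintype Cp] [Fintype K] {ν : ℕ}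

/-! ## §1 Disjoint cells covering the support -/

section Cover

variable (n : K → ℕ) (φ : (k : K) → Box ν (n k) → St)

/-- **Disjoint charted cells covering the support carry the whole mass**: `Σ_p f(p)² = Σ_k Σ_v Σ_i f(φ_k v, i)²`. [folklore] -/
theorem sum_sq_eq_sum_cells (hinj : Injective (fun p : (Σ k, Box ν (n k)) => φ p.1 p.2)) (f : St × Cp → ℝ)
    (hcover : ∀ x i, f (x, i) ≠ 0 → ∃ k v, φ k v = x) :
    ∑ p, f p ^ 2 = ∑ k, ∑ v : Box ν (n k), ∑ i, f (φ k v, i) ^ 2 := by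
  classical
  have hcells : ∑ k, ∑ v : Box ν (n k), ∑ i, f (φ k v, i) ^ 2 =
      ∑ x ∈ Finset.univ.image (fun p : (Σ k, Box ν (n k)) => φ p.1 p.2), ∑ i, f (x, i) ^ 2 := by
    rw [Finset.sum_image fun p _ q _ h => hinj h, ← Finset.univ_sigma_univ, Finset.sum_sigma]
  rw [hcells, Fintype.sum_prod_type]
  symm
  refine Finset.sum_subset (Finset.subset_univ _) fun x _ hx => ?_
  refine Finset.sum_eq_zero fun i _ => ?_
  by_contra hne
  have hfi : f (x, i) ≠ 0 := fun h0 => hne (by rw [h0]; ring)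
  obtain ⟨k, v, hkv⟩ := hcover x i hfi
  exact hx (Finset.mem_image.mpr ⟨⟨k, v⟩, Finset.mem_univ _, hkv⟩)

/-- A weighted cell sum with weights `≥ w_min` dominates `w_min·‖f‖²` when the cells cover the support. [folklore] -/
theorem sum_cells_weight_ge (hinj : Injective (fun p : (Σ k, Box ν (n k)) => φ p.1 p.2)) (f : St × Cp → ℝ)
    (hcover : ∀ x i, f (x, i) ≠ 0 → ∃ k v, φ k v = x) (w : K → ℝ) {wmin : ℝ} (hw : ∀ k, wmin ≤ w k) :
    wmin * ∑ p, f p ^ 2 ≤ ∑ k, w k * ∑ v : Box ν (n k), ∑ i, f (φ k v, i) ^ 2 := by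
  rw [sum_sq_eq_sum_cells n φ hinj f hcover, Finset.mul_sum]
  exact Finset.sum_le_sum fun k _ =>
    mul_le_mul_of_nonneg_right (hw k) (sum_nonneg fun _ _ => sum_nonneg fun _ _ => sq_nonneg _)

end Cover

/-! ## §2 The global lower bounds for supported fields -/

section Ends

variable [Fintype Bd] [Fintype B] [DecidableEq Cp] [Fintype J] (src tgt : Bd → St) (c : Bd → ℝ)
  (Rm : Bd → Cp → Cp → ℝ) (blk : J → St → B) (W : J → St → ℝ) (T : J → St → Cp → Cp → ℝ) (a : J → ℝ)
  (n : K → ℕ) (lvl : K → J) (lab : K → B) (wt hd : K → ℝ)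
  (φ : (k : K) → Box ν (n k) → St)
  (e : (k : K) → (v : Box ν (n k)) → (i : Fin ν) → ((v i : ℕ) + 1 < n k) → Bd)

/-- Elementary: `n ≤ n_max`, `1 ≤ n` ⟹ `(n_max²)⁻¹ ≤ (n²)⁻¹`. [folklore] -/
theorem inv_sq_le_inv_sq {m nmax : ℕ} (hm : 1 ≤ m) (hle : m ≤ nmax) : ((nmax : ℝ) ^ 2)⁻¹ ≤ ((m : ℝ) ^ 2)⁻¹ := by
  have hm' : (0 : ℝ) < m := by exact_mod_cast hm
  have hle' : (m : ℝ) ≤ nmax := by exact_mod_cast hle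
  exact inv_anti₀ (by positivity) (pow_le_pow_left₀ hm'.le hle' 2)

/-- **GLOBAL LOWER BOUND FOR SUPPORTED FIELDS, tree-gauge route (MODEL).**  Under the hypotheses of
`MultiscaleCoercive.multiscale_coercive_scaled`, if moreover the cells are jointly injective, cover the support of `f`, and have
sides `≤ n_max`, then `(1 − θ)·min(c²/(4ν), a_min/2)·n_max⁻²·Σ_p f(p)² ≤ ⟨f, levelOp f⟩` — for the Dirichlet problem on a hull made of
level-`l` cells: constant `κ/S_l²`, independent of the hull and of the number of levels.
[cite: Balaban1985BackgroundPropagators, (3.24) p.394 + Thm 3.1 p.397; Balaban1984PropagatorsII, (2.43) p.230] -/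
theorem coercive_of_cover
    (hT : ∀ j x i i', ∑ k, T j x k i * T j x k i' = if i = i' then (1 : ℝ) else 0) {cmin : ℝ} (hcmin : 0 < cmin)
    (hφinj : ∀ k, Injective (φ k)) (hφblk : ∀ k x, blk (lvl k) x = lab k ↔ ∃ v, φ k v = x)
    (hW : ∀ k v, W (lvl k) (φ k v) = wt k)
    (hsrc : ∀ k v i hv, src (e k v i hv) = φ k v) (htgt : ∀ k v i hv, tgt (e k v i hv) = φ k (succ v i hv))
    (hcb : ∀ k v i hv, cmin ≤ |c (e k v i hv)|)
    (hHol : ∀ k v i hv (u : Cp → ℝ),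
      ∑ a', (∑ j, (hol Rm (fun v => T (lvl k) (φ k v)) (e k) v i hv a' j - if a' = j then 1 else 0) * u j) ^ 2 ≤
        hd k ^ 2 * ∑ j, u j ^ 2)
    (hbond : ∀ F : Bd → ℝ, (∀ b, 0 ≤ F b) →
      ∑ k, ∑ v : Box ν (n k), ∑ i : Fin ν, (if hv : (v i : ℕ) + 1 < n k then F (e k v i hv) else 0) ≤ ∑ b, F b)
    (hcell : ∀ A : J → B → ℝ, (∀ j β, 0 ≤ A j β) → ∑ k, a (lvl k) * A (lvl k) (lab k) ≤ ∑ j, a j * ∑ β, A j β)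
    (hν : 1 ≤ ν) (hn : ∀ k, 1 ≤ n k) {amin : ℝ} (hamin : 0 ≤ amin)
    (hscale : ∀ k, amin / (n k : ℝ) ^ 2 ≤ a (lvl k) * wt k ^ 2 * (n k : ℝ) ^ ν) {θ : ℝ} (hθ : θ ≤ 1)
    (hloss : ∀ k, 4 * ((ν : ℝ) * (n k) * ((n k : ℝ) - 1)) * ν * hd k ^ 2 ≤ θ)
    (hinj : Injective (fun p : (Σ k, Box ν (n k)) => φ p.1 p.2)) {nmax : ℕ} (hnmax : ∀ k, n k ≤ nmax)
    (f : St × Cp → ℝ) (hcover : ∀ x i, f (x, i) ≠ 0 → ∃ k v, φ k v = x) :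
    (1 - θ) * min (cmin ^ 2 / (4 * ν)) (amin / 2) * ((nmax : ℝ) ^ 2)⁻¹ * ∑ p, f p ^ 2 ≤
      ∑ p, f p * levelOp src tgt c Rm blk W T a f p := by
  have hmain := multiscale_coercive_scaled src tgt c Rm blk W T a n lvl lab wt hd φ e hT hcmin hφinj hφblk hW hsrc htgt hcb
    hHol hbond hcell hν hn hamin hscale hloss f
  refine le_trans ?_ hmain
  have hνr : (1 : ℝ) ≤ ν := by exact_mod_cast hν
  have hκ : 0 ≤ (1 - θ) * min (cmin ^ 2 / (4 * ν)) (amin / 2) :=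
    mul_nonneg (by linarith) (le_min (by positivity) (by positivity))
  have hcells := sum_cells_weight_ge n φ hinj f hcover (fun k => ((n k : ℝ) ^ 2)⁻¹)
    fun k => inv_sq_le_inv_sq (hn k) (hnmax k)
  calc (1 - θ) * min (cmin ^ 2 / (4 * ν)) (amin / 2) * ((nmax : ℝ) ^ 2)⁻¹ * ∑ p, f p ^ 2
      = (1 - θ) * min (cmin ^ 2 / (4 * ν)) (amin / 2) * (((nmax : ℝ) ^ 2)⁻¹ * ∑ p, f p ^ 2) := by ring
    _ ≤ (1 - θ) * min (cmin ^ 2 / (4 * ν)) (amin / 2) *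
          ∑ k, ((n k : ℝ) ^ 2)⁻¹ * ∑ v : Box ν (n k), ∑ i, f (φ k v, i) ^ 2 := mul_le_mul_of_nonneg_left hcells hκ

variable (ε δ : K → ℝ) (g : (k : K) → Box ν (n k) → Cp → Cp → ℝ) (O : K → Cp → Cp → ℝ)

/-- **GLOBAL LOWER BOUND FOR SUPPORTED FIELDS, |A|-half route (MODEL).**  Under the hypotheses of
`MultiscaleCoerciveGauge.multiscale_coercive_gauge_scaled`, with jointly injective cells covering the support and sides `≤ n_max`:
`(1 − θ)·min(c²/(4ν), a_min/4)·n_max⁻²·Σ_p f(p)² ≤ ⟨f, levelOp f⟩`.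
[cite: Balaban1985BackgroundPropagators, (3.24) p.394 + (3.35) p.396 + Thm 3.1 p.397; Balaban1984PropagatorsII, (2.43) p.230] -/
theorem coercive_of_cover_gauge
    (hT : ∀ j x i i', ∑ k, T j x k i * T j x k i' = if i = i' then (1 : ℝ) else 0) {cmin : ℝ} (hcmin : 0 < cmin)
    (hφinj : ∀ k, Injective (φ k)) (hφblk : ∀ k x, blk (lvl k) x = lab k ↔ ∃ v, φ k v = x)
    (hW : ∀ k v, W (lvl k) (φ k v) = wt k)
    (hsrc : ∀ k v i hv, src (e k v i hv) = φ k v) (htgt : ∀ k v i hv, tgt (e k v i hv) = φ k (succ v i hv))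
    (hcb : ∀ k v i hv, cmin ≤ |c (e k v i hv)|)
    (hg : ∀ k v i i', ∑ k', g k v k' i * g k v k' i' = if i = i' then (1 : ℝ) else 0)
    (hO : ∀ k i i', ∑ k', O k k' i * O k k' i' = if i = i' then (1 : ℝ) else 0)
    (hgauge : ∀ k v i hv (u : Cp → ℝ),
      ∑ a', (∑ j, (hol Rm (g k) (e k) v i hv a' j - if a' = j then 1 else 0) * u j) ^ 2 ≤ ε k ^ 2 * ∑ j, u j ^ 2)
    (hcmp : ∀ k v (u : Cp → ℝ),
      ∑ a', (∑ j, cmpD (fun v => T (lvl k) (φ k v)) (g k) (O k) v a' j * u j) ^ 2 ≤ δ k ^ 2 * ∑ j, u j ^ 2)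
    (hbond : ∀ F : Bd → ℝ, (∀ b, 0 ≤ F b) →
      ∑ k, ∑ v : Box ν (n k), ∑ i : Fin ν, (if hv : (v i : ℕ) + 1 < n k then F (e k v i hv) else 0) ≤ ∑ b, F b)
    (hcell : ∀ A : J → B → ℝ, (∀ j β, 0 ≤ A j β) → ∑ k, a (lvl k) * A (lvl k) (lab k) ≤ ∑ j, a j * ∑ β, A j β)
    (hν : 1 ≤ ν) (hn : ∀ k, 1 ≤ n k) {amin : ℝ} (hamin : 0 ≤ amin)
    (hscale : ∀ k, amin / (n k : ℝ) ^ 2 ≤ a (lvl k) * wt k ^ 2 * (n k : ℝ) ^ ν) {θ : ℝ} (hθ : θ ≤ 1)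
    (hloss : ∀ k, 4 * ((ν : ℝ) * (n k) * ((n k : ℝ) - 1)) * ν * ε k ^ 2 + 4 * δ k ^ 2 ≤ θ)
    (hinj : Injective (fun p : (Σ k, Box ν (n k)) => φ p.1 p.2)) {nmax : ℕ} (hnmax : ∀ k, n k ≤ nmax)
    (f : St × Cp → ℝ) (hcover : ∀ x i, f (x, i) ≠ 0 → ∃ k v, φ k v = x) :
    (1 - θ) * min (cmin ^ 2 / (4 * ν)) (amin / 4) * ((nmax : ℝ) ^ 2)⁻¹ * ∑ p, f p ^ 2 ≤
      ∑ p, f p * levelOp src tgt c Rm blk W T a f p := by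
  have hmain := multiscale_coercive_gauge_scaled src tgt c Rm blk W T a n lvl lab wt ε δ φ e g O hT hcmin hφinj hφblk hW
    hsrc htgt hcb hg hO hgauge hcmp hbond hcell hν hn hamin hscale hloss f
  refine le_trans ?_ hmain
  have hνr : (1 : ℝ) ≤ ν := by exact_mod_cast hν
  have hκ : 0 ≤ (1 - θ) * min (cmin ^ 2 / (4 * ν)) (amin / 4) :=
    mul_nonneg (by linarith) (le_min (by positivity) (by positivity))
  have hcells := sum_cells_weight_ge n φ hinj f hcover (fun k => ((n k : ℝ) ^ 2)⁻¹)
    fun k => inv_sq_le_inv_sq (hn k) (hnmax k)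
  calc (1 - θ) * min (cmin ^ 2 / (4 * ν)) (amin / 4) * ((nmax : ℝ) ^ 2)⁻¹ * ∑ p, f p ^ 2
      = (1 - θ) * min (cmin ^ 2 / (4 * ν)) (amin / 4) * (((nmax : ℝ) ^ 2)⁻¹ * ∑ p, f p ^ 2) := by ring
    _ ≤ (1 - θ) * min (cmin ^ 2 / (4 * ν)) (amin / 4) *
          ∑ k, ((n k : ℝ) ^ 2)⁻¹ * ∑ v : Box ν (n k), ∑ i, f (φ k v, i) ^ 2 := mul_le_mul_of_nonneg_left hcells hκ

end Ends

end

end Summit.QuantumFields.BalabanUV.Beta.MultiscaleCoerciveCover
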